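import Summits.CriticalPhenomena.PercolationContinuityZ3.Theorems.PercNearOneGluingNoHeavyLowerTailSahiCylinderComplementsTwo
import Summits.CriticalPhenomena.PercolationContinuityZ3.Theorems.PercNearOneGluingNoHeavyLowerTailSahiE3Sections
import HarnessLib

/-!
# Kahn's Conjecture 5 for TWO complements of cylinders and an ARBITRARY decreasing event — general ground set

Support file (prover prim-ineq-prove-3 gen 13; `--supports stmt-CriticalPhenomena-4575`).  No definitions, no named facts, no sorries,
no `native_decide`.  Sequel of `…SahiCylinderComplementsTwo` (`sahiE3_cylCompl_cylCompl_lower_nonneg`, which assumes `F ∪ G = univ`):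
here the restriction on the ground set is REMOVED.

**THEOREM (`sahiE3_cylCompl_cylCompl_lower_nonneg_all`).**  Let `prodBernoulli p` be a product probability measure on `Set ι`
(`ι` finite), `F, G ⊆ ι` arbitrary finite sets, and `W` ANY decreasing event.  Then
  `0 ≤ E₃({F ⊆ ω}ᶜ, {G ⊆ ω}ᶜ, W)`.
Equivalently (cube flip `ω ↦ ωᶜ, p ↦ 1 − p`, not restated): `E₃(U_F, U_G, X) ≥ 0` for two "OR" events `U_S = {ω ∩ S ≠ ∅}` and any
increasing `X`; and, by the complement rule, the UPPER bound `E₃(V_F, V_G, X) ≤ Cov(V_F,V_G) + Cov(V_F,X) + Cov(V_G,X)` for two cylinders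
and any up-set `X`, dual to the tree's lower bound `0 ≤ E₃(V_F, ·, ·)`.

PROOF.  (1) ONE-COORDINATE SECTIONS (file `…SahiE3Sections`, namespace `SahiE3Sections`).  For an event `W` and a coordinate `e` put `W¹ = {ω | insert e ω ∈ W}`, `W⁰ = {ω | ω ∖ {e} ∈ W}`
(both determined by the coordinates `≠ e`, decreasing if `W` is).  For every event `S` determined by the coordinates `≠ e`,
`μ(S ∩ W) = p_e μ(S ∩ W¹) + (1 − p_e) μ(S ∩ W⁰)` (`real_inter_section_split`; independence of `{e ∈ ω}` from events determined off `e`).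
Since `E₃(A, B, ·)` is affine in the indicator of its third argument, for `A, B` determined off `e`:
  `E₃(A, B, W) = p_e E₃(A, B, W¹) + (1 − p_e) E₃(A, B, W⁰)`   (`sahiE3_section_split_third`).
(2) BASE CASE (`sahiE3_cylCompl_cylCompl_lower_nonneg_of_determinedBy`): if `W` is determined by `F ∪ G` the proof of the `F ∪ G = univ`
theorem goes through verbatim with "determined by `F ∪ G`" in place of "`F ∪ G = univ`": the section events `A₂ = {ω | ω ∪ F ∈ U}`,
`A₁ = {ω | ω ∪ G ∈ U}` (`U = Wᶜ`) are determined by the DISJOINT blocks `G ∖ F`, `F ∖ G`, so `μ(U) ≤ μ(A₁)μ(A₂)`, and the polynomial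
inequality `ccdPoly_nonneg` of the previous file concludes.
(3) INDUCTION on a finite set `H` of extra coordinates with `W` determined by `F ∪ G ∪ H`: peel `e ∈ H ∖ (F ∪ G)` by (1) — the cylinder
complements are determined off `e`, the sections of `W` are decreasing and determined by `F ∪ G ∪ (H ∖ e)` — and average two nonnegative
numbers.  `H = univ` gives the theorem.

PERCOLATION READING: on every finite FOREST with arbitrary edge weights, `{u ↮ v}` = "some edge of the `u–v` path is closed" is a cylinder
complement, so EVERY cubic row `E₃(D[u₁|v₁], D[u₂|v₂], W) ≥ 0` with two singleton separations and an arbitrary decreasing third event holds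
on forests, all `n` (e.g. row 44 `(D[ab|cy], D[a|b], D[c|y])` of the four-point frontier; the path identification is not formalised here).
-/

noncomputable section

namespace Summit.CriticalPhenomena.PercolationContinuityZ3.Theorems

namespace SahiCylinderComplements

open MeasureTheory Literature.Probability.LatticeModels Literature.Probability.Percolation SahiE3Sections
open scoped Classical

variable {ι : Type*} [Fintype ι]

/-! ### The base case: `W` determined by `F ∪ G` -/

/-- **Base case (two cylinder complements and a decreasing event determined by `F ∪ G`).**  For `W` decreasing and determined by the
coordinates of `F ∪ G`: `0 ≤ E₃({F⊆ω}ᶜ, {G⊆ω}ᶜ, W)` under every product measure — the proof of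
`sahiE3_cylCompl_cylCompl_lower_nonneg` with "determined by `F ∪ G`" replacing "`F ∪ G = univ`". [this work] -/
theorem sahiE3_cylCompl_cylCompl_lower_nonneg_of_determinedBy (p : ι → unitInterval) (F G : Finset ι)
    (W : Set (Set ι)) (hW : IsLowerSet W) (hWdet : DeterminedBy W ((F ∪ G : Finset ι) : Set ι)) :
    0 ≤ sahiE3 (prodBernoulli p) {ω : Set ι | (F : Set ι) ⊆ ω}ᶜ {ω : Set ι | (G : Set ι) ⊆ ω}ᶜ W := by
  classical
  set μ := prodBernoulli p with hμ
  set VF : Set (Set ι) := {ω | (F : Set ι) ⊆ ω} with hVF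
  set VG : Set (Set ι) := {ω | (G : Set ι) ⊆ ω} with hVG
  set U : Set (Set ι) := Wᶜ with hU
  have hWU : W = Uᶜ := by rw [hU, compl_compl]
  have hUup : IsUpperSet U := hW.compl
  have hUdet : DeterminedBy U ((F ∪ G : Finset ι) : Set ι) := Quant.determinedBy_compl_of hWdet
  -- Case U = ∅ : W = univ, E₃ = Cov of the two cylinder complements ≥ 0 (Harris)
  by_cases hUe : U = ∅
  · have hWuniv : W = Set.univ := by rw [hWU, hUe, Set.compl_empty]
    rw [hWuniv, sahiE3_def]
    simp only [Set.inter_univ, probReal_univ, mul_one, one_mul]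
    have hlF : IsLowerSet VFᶜ := fun ω ω' hle hω' hω => hω' fun _ hi => hle (hω hi)
    have hlG : IsLowerSet VGᶜ := fun ω ω' hle hω' hω => hω' fun _ hi => hle (hω hi)
    have h := prodBernoulli_harris_lower p hlF hlG MeasurableSet.of_discrete MeasurableSet.of_discrete
    rw [← hμ] at h
    nlinarith [h]
  -- Main case: U nonempty up-set, hence univ ∈ U
  have hUne : U.Nonempty := Set.nonempty_iff_ne_empty.2 hUe
  have htop : (Set.univ : Set ι) ∈ U := by
    obtain ⟨ω, hω⟩ := hUne
    exact hUup (Set.subset_univ ω) hω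
  -- every configuration containing `F ∪ G` lies in `U` (it agrees with `univ` on `F ∪ G`)
  have hsupU : ∀ ω : Set ι, ((F ∪ G : Finset ι) : Set ι) ⊆ ω → ω ∈ U := by
    intro ω hω
    have key := (determinedBy_iff _ _).1 hUdet ω Set.univ
      (by rw [Set.univ_inter, Set.inter_eq_right.2 hω])
    exact key.2 htop
  -- the section events
  set A₂ : Set (Set ι) := {ω | ω ∪ (F : Set ι) ∈ U} with hA₂
  set A₁ : Set (Set ι) := {ω | ω ∪ (G : Set ι) ∈ U} with hA₁
  -- U ⊆ A₁ ∩ A₂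
  have hUA : U ⊆ A₁ ∩ A₂ := fun ω hω => ⟨hUup Set.subset_union_left hω, hUup Set.subset_union_left hω⟩
  -- VF ∩ U = VF ∩ A₂, VG ∩ U = VG ∩ A₁
  have hUVF : VF ∩ U = VF ∩ A₂ := by
    ext ω; simp only [Set.mem_inter_iff, hVF, Set.mem_setOf_eq, hA₂]
    constructor
    · rintro ⟨h1, h2⟩; exact ⟨h1, by rwa [Set.union_eq_self_of_subset_right h1]⟩
    · rintro ⟨h1, h2⟩; exact ⟨h1, by rwa [Set.union_eq_self_of_subset_right h1] at h2⟩
  have hUVG : VG ∩ U = VG ∩ A₁ := by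
    ext ω; simp only [Set.mem_inter_iff, hVG, Set.mem_setOf_eq, hA₁]
    constructor
    · rintro ⟨h1, h2⟩; exact ⟨h1, by rwa [Set.union_eq_self_of_subset_right h1]⟩
    · rintro ⟨h1, h2⟩; exact ⟨h1, by rwa [Set.union_eq_self_of_subset_right h1] at h2⟩
  -- VF ∩ VG = {F ∪ G ⊆ ω} and VF ∩ VG ∩ U = VF ∩ VG
  have hVFG : VF ∩ VG = {ω : Set ι | ((F ∪ G : Finset ι) : Set ι) ⊆ ω} := cyl_inter_cyl F G
  have hVFGU : VF ∩ VG ∩ U = VF ∩ VG := by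
    apply Set.inter_eq_left.2
    intro ω hω
    rw [hVFG] at hω
    exact hsupU ω hω
  -- independence facts
  have hdetA₂K : DeterminedBy A₂ (((F ∪ G : Finset ι) : Set ι) \ (F : Set ι)) := determinedBy_union_mem_of hUdet (F : Set ι)
  have hdetA₁K : DeterminedBy A₁ (((F ∪ G : Finset ι) : Set ι) \ (G : Set ι)) := determinedBy_union_mem_of hUdet (G : Set ι)
  have hdetA₂ : DeterminedBy A₂ ((F : Set ι))ᶜ := hdetA₂K.mono fun i hi => hi.2
  have hdetA₁ : DeterminedBy A₁ ((G : Set ι))ᶜ := hdetA₁K.mono fun i hi => hi.2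
  have hμFA : μ.real (VF ∩ A₂) = μ.real VF * μ.real A₂ :=
    prodBernoulli_real_inter_of_determinedBy p F (determinedBy_cyl F) hdetA₂ MeasurableSet.of_discrete MeasurableSet.of_discrete
  have hμGA : μ.real (VG ∩ A₁) = μ.real VG * μ.real A₁ :=
    prodBernoulli_real_inter_of_determinedBy p G (determinedBy_cyl G) hdetA₁ MeasurableSet.of_discrete MeasurableSet.of_discrete
  -- u ≤ σ τ : A₁ determined by F \ G, A₂ by G \ F, disjoint
  have hdisj : Disjoint (F \ G) (G \ F) :=
    Finset.disjoint_left.2 fun i h1 h2 => (Finset.mem_sdiff.1 h1).2 (Finset.mem_sdiff.1 h2).1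
  have hdetA₁' : DeterminedBy A₁ ((F \ G : Finset ι) : Set ι) :=
    hdetA₁K.mono fun i hi => by
      simp only [Finset.coe_union, Set.mem_sdiff, Set.mem_union, Finset.mem_coe] at hi
      simp only [Finset.coe_sdiff, Set.mem_sdiff, Finset.mem_coe]
      tauto
  have hdetA₂' : DeterminedBy A₂ ((G \ F : Finset ι) : Set ι) :=
    hdetA₂K.mono fun i hi => by
      simp only [Finset.coe_union, Set.mem_sdiff, Set.mem_union, Finset.mem_coe] at hi
      simp only [Finset.coe_sdiff, Set.mem_sdiff, Finset.mem_coe]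
      tauto
  have hμA : μ.real (A₁ ∩ A₂) = μ.real A₁ * μ.real A₂ :=
    prodBernoulli_real_inter_of_determinedBy_disjoint p hdisj hdetA₁' hdetA₂' MeasurableSet.of_discrete MeasurableSet.of_discrete
  have hu_le : μ.real U ≤ μ.real A₁ * μ.real A₂ := by
    rw [← hμA]; exact measureReal_mono hUA
  -- σ ≥ b, τ ≥ a
  have hA₂sup : {ω : Set ι | ((G \ F : Finset ι) : Set ι) ⊆ ω} ⊆ A₂ := by
    intro ω hω
    simp only [Set.mem_setOf_eq, Finset.coe_sdiff] at hω
    simp only [hA₂, Set.mem_setOf_eq]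
    apply hsupU
    intro i hi
    simp only [Finset.coe_union, Set.mem_union, Finset.mem_coe] at hi
    by_cases hiF : i ∈ F
    · exact Or.inr (Finset.mem_coe.2 hiF)
    · have hiG : i ∈ G := hi.resolve_left hiF
      exact Or.inl (hω ⟨Finset.mem_coe.2 hiG, fun h => hiF (Finset.mem_coe.1 h)⟩)
  have hA₁sup : {ω : Set ι | ((F \ G : Finset ι) : Set ι) ⊆ ω} ⊆ A₁ := by
    intro ω hω
    simp only [Set.mem_setOf_eq, Finset.coe_sdiff] at hω
    simp only [hA₁, Set.mem_setOf_eq]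
    apply hsupU
    intro i hi
    simp only [Finset.coe_union, Set.mem_union, Finset.mem_coe] at hi
    by_cases hiG : i ∈ G
    · exact Or.inr (Finset.mem_coe.2 hiG)
    · have hiF : i ∈ F := hi.resolve_right hiG
      exact Or.inl (hω ⟨Finset.mem_coe.2 hiF, fun h => hiG (Finset.mem_coe.1 h)⟩)
  have hσb : ∏ i ∈ G \ F, (p i : ℝ) ≤ μ.real A₂ := by
    rw [← prodBernoulli_real_subset p (G \ F), ← hμ]; exact measureReal_mono hA₂sup
  have hτa : ∏ i ∈ F \ G, (p i : ℝ) ≤ μ.real A₁ := by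
    rw [← prodBernoulli_real_subset p (F \ G), ← hμ]; exact measureReal_mono hA₁sup
  -- products as Venn products
  set a := ∏ i ∈ F \ G, (p i : ℝ) with ha
  set b := ∏ i ∈ G \ F, (p i : ℝ) with hb
  set d := ∏ i ∈ F ∩ G, (p i : ℝ) with hd
  have eF : ∏ i ∈ F, (p i : ℝ) = a * d := by
    rw [ha, hd, ← Finset.prod_union (Finset.disjoint_left.2 fun i h1 h2 => (Finset.mem_sdiff.1 h1).2 (Finset.mem_inter.1 h2).2)]
    congr 1; ext i; simp only [Finset.mem_union, Finset.mem_sdiff, Finset.mem_inter]; tauto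
  have eG : ∏ i ∈ G, (p i : ℝ) = b * d := by
    rw [hb, hd, ← Finset.prod_union (Finset.disjoint_left.2 fun i h1 h2 => (Finset.mem_sdiff.1 h1).2 (Finset.mem_inter.1 h2).1)]
    congr 1; ext i; simp only [Finset.mem_union, Finset.mem_sdiff, Finset.mem_inter]; tauto
  have eFG : ∏ i ∈ F ∪ G, (p i : ℝ) = a * b * d := by
    have h1 : Disjoint (F \ G) (G \ F) := Finset.disjoint_left.2 fun i h1 h2 => (Finset.mem_sdiff.1 h1).2 (Finset.mem_sdiff.1 h2).1
    have h2 : Disjoint (F \ G ∪ G \ F) (F ∩ G) := Finset.disjoint_left.2 fun i hi h3 => by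
      rcases Finset.mem_union.1 hi with h | h
      · exact (Finset.mem_sdiff.1 h).2 (Finset.mem_inter.1 h3).2
      · exact (Finset.mem_sdiff.1 h).2 (Finset.mem_inter.1 h3).1
    rw [ha, hb, hd, ← Finset.prod_union h1, ← Finset.prod_union h2]
    congr 1; ext i; simp only [Finset.mem_union, Finset.mem_sdiff, Finset.mem_inter]; tauto
  -- measures of the cylinders and intersections
  have mVF : μ.real VF = a * d := by rw [hμ, hVF, prodBernoulli_real_subset, eF]
  have mVG : μ.real VG = b * d := by rw [hμ, hVG, prodBernoulli_real_subset, eG]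
  have mVFG : μ.real (VF ∩ VG) = a * b * d := by rw [hVFG, hμ, prodBernoulli_real_subset, eFG]
  -- bounds on a b d σ τ u
  have ha0 : 0 ≤ a := Finset.prod_nonneg fun i _ => (p i).2.1
  have ha1 : a ≤ 1 := Finset.prod_le_one (fun i _ => (p i).2.1) fun i _ => (p i).2.2
  have hb0 : 0 ≤ b := Finset.prod_nonneg fun i _ => (p i).2.1
  have hb1 : b ≤ 1 := Finset.prod_le_one (fun i _ => (p i).2.1) fun i _ => (p i).2.2
  have hd0 : 0 ≤ d := Finset.prod_nonneg fun i _ => (p i).2.1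
  have hd1 : d ≤ 1 := Finset.prod_le_one (fun i _ => (p i).2.1) fun i _ => (p i).2.2
  have hσ1 : μ.real A₂ ≤ 1 := by rw [hμ]; exact measureReal_le_one
  have hτ1 : μ.real A₁ ≤ 1 := by rw [hμ]; exact measureReal_le_one
  have hpoly := ccdPoly_nonneg a b d (μ.real A₂) (μ.real A₁) (μ.real U) ha0 ha1 hb0 hb1 hd0 hd1 hσb hσ1 hτa hτ1
    (by rw [mul_comm]; exact hu_le)
  -- rewrite E₃
  have hm : ∀ S : Set (Set ι), MeasurableSet S := fun S => MeasurableSet.of_discrete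
  rw [hWU, sahiE3_compl μ (hm _) (hm _) (hm _), sahiE3_def]
  rw [hVFGU, hUVF, hUVG, hμFA, hμGA, mVF, mVG, mVFG]
  have hid : a * b * d - a * d * (b * d) + (a * d * μ.real A₂ - a * d * μ.real U) + (b * d * μ.real A₁ - b * d * μ.real U) -
      (2 * (a * b * d) + a * d * (b * d) * μ.real U -
        (a * d * (b * d * μ.real A₁) + b * d * (a * d * μ.real A₂) + μ.real U * (a * b * d))) =
      d * (a * (μ.real A₂ - μ.real U) + b * (μ.real A₁ - μ.real U) - a * b * (1 - μ.real U) -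
        a * b * d * (1 + μ.real U - μ.real A₂ - μ.real A₁)) := by ring
  rw [hid]
  exact mul_nonneg hd0 hpoly

/-! ### The general theorem -/

/-- **THEOREM (two cylinder complements and an ARBITRARY decreasing event — every ground set).**  For every product probability
measure `prodBernoulli p` on `Set ι` (`ι` finite), all finite `F, G ⊆ ι` and every decreasing `W`:
`0 ≤ E₃({F⊆ω}ᶜ, {G⊆ω}ᶜ, W)`.  (Kahn's Conjecture 5 / Richards–Sahi `C₃` for this class of triples.) [this work] -/
theorem sahiE3_cylCompl_cylCompl_lower_nonneg_all (p : ι → unitInterval) (F G : Finset ι)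
    (W : Set (Set ι)) (hW : IsLowerSet W) :
    0 ≤ sahiE3 (prodBernoulli p) {ω : Set ι | (F : Set ι) ⊆ ω}ᶜ {ω : Set ι | (G : Set ι) ⊆ ω}ᶜ W := by
  classical
  -- strengthened statement: induction on a finite set `H` of extra coordinates
  suffices h : ∀ (H : Finset ι) (W : Set (Set ι)), IsLowerSet W → DeterminedBy W ((F ∪ G ∪ H : Finset ι) : Set ι) →
      0 ≤ sahiE3 (prodBernoulli p) {ω : Set ι | (F : Set ι) ⊆ ω}ᶜ {ω : Set ι | (G : Set ι) ⊆ ω}ᶜ W by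
    refine h Finset.univ W hW ?_
    have huniv : ((F ∪ G ∪ Finset.univ : Finset ι) : Set ι) = Set.univ := by simp
    rw [huniv]
    exact determinedBy_univ_set W
  intro H
  induction H using Finset.induction_on with
  | empty =>
    intro W hW hdet
    rw [Finset.union_empty] at hdet
    exact sahiE3_cylCompl_cylCompl_lower_nonneg_of_determinedBy p F G W hW hdet
  | insert e H heH ih =>
    intro W hW hdet
    by_cases he : e ∈ F ∪ G
    · -- `e` is already a coordinate of `F ∪ G`: nothing to peel
      refine ih W hW (hdet.mono fun i hi => ?_)
      simp only [Finset.coe_union, Finset.coe_insert, Set.mem_union, Finset.mem_coe, Set.mem_insert_iff] at hi ⊢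
      rcases hi with hi | rfl | hi
      · exact Or.inl hi
      · exact Or.inl (Finset.mem_union.1 he)
      · exact Or.inr hi
    · -- peel the coordinate `e ∉ F ∪ G`
      have heF : e ∉ F := fun h => he (Finset.mem_union.2 (Or.inl h))
      have heG : e ∉ G := fun h => he (Finset.mem_union.2 (Or.inr h))
      have hA : DeterminedBy {ω : Set ι | (F : Set ι) ⊆ ω}ᶜ ((({e} : Finset ι) : Set ι)ᶜ) :=
        Quant.determinedBy_compl_of ((determinedBy_cyl F).mono fun i hi => by
          simp only [Finset.coe_singleton, Set.mem_compl_iff, Set.mem_singleton_iff]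
          rintro rfl; exact heF (Finset.mem_coe.1 hi))
      have hB : DeterminedBy {ω : Set ι | (G : Set ι) ⊆ ω}ᶜ ((({e} : Finset ι) : Set ι)ᶜ) :=
        Quant.determinedBy_compl_of ((determinedBy_cyl G).mono fun i hi => by
          simp only [Finset.coe_singleton, Set.mem_compl_iff, Set.mem_singleton_iff]
          rintro rfl; exact heG (Finset.mem_coe.1 hi))
      -- the sections are determined by `F ∪ G ∪ H`
      have hsub : (((F ∪ G ∪ insert e H : Finset ι) : Set ι) \ {e}) ⊆ ((F ∪ G ∪ H : Finset ι) : Set ι) := by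
        intro i hi
        simp only [Set.mem_sdiff, Finset.mem_coe, Finset.mem_union, Finset.mem_insert, Set.mem_singleton_iff] at hi
        simp only [Finset.coe_union, Set.mem_union, Finset.mem_coe]
        tauto
      have h1 := ih {ω : Set ι | insert e ω ∈ W} (isLowerSet_section_insert hW e)
        ((determinedBy_section_insert hdet e).mono hsub)
      have h0 := ih {ω : Set ι | ω \ {e} ∈ W} (isLowerSet_section_sdiff hW e)
        ((determinedBy_section_sdiff hdet e).mono hsub)
      rw [sahiE3_section_split_third p e hA hB W]
      have hp0 : 0 ≤ (p e : ℝ) := (p e).2.1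
      have hp1 : (p e : ℝ) ≤ 1 := (p e).2.2
      have hq0 : 0 ≤ 1 - (p e : ℝ) := sub_nonneg.2 hp1
      exact add_nonneg (mul_nonneg hp0 h1) (mul_nonneg hq0 h0)

/-- **Corollary (upper bound for two cylinders and an up-set).**  For cylinders `V_F, V_G` and ANY increasing `X`:
`E₃(V_F, V_G, X) ≤ Cov(V_F,V_G) + Cov(V_F,X) + Cov(V_G,X)` (complement rule). [this work] -/
theorem sahiE3_cyl_cyl_upper_le (p : ι → unitInterval) (F G : Finset ι) (X : Set (Set ι)) (hX : IsUpperSet X) :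
    sahiE3 (prodBernoulli p) {ω : Set ι | (F : Set ι) ⊆ ω} {ω : Set ι | (G : Set ι) ⊆ ω} X ≤
      ((prodBernoulli p).real ({ω : Set ι | (F : Set ι) ⊆ ω} ∩ {ω : Set ι | (G : Set ι) ⊆ ω}) -
          (prodBernoulli p).real {ω : Set ι | (F : Set ι) ⊆ ω} * (prodBernoulli p).real {ω : Set ι | (G : Set ι) ⊆ ω}) +
        ((prodBernoulli p).real ({ω : Set ι | (F : Set ι) ⊆ ω} ∩ X) -
          (prodBernoulli p).real {ω : Set ι | (F : Set ι) ⊆ ω} * (prodBernoulli p).real X) +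
        ((prodBernoulli p).real ({ω : Set ι | (G : Set ι) ⊆ ω} ∩ X) -
          (prodBernoulli p).real {ω : Set ι | (G : Set ι) ⊆ ω} * (prodBernoulli p).real X) := by
  have hm : ∀ S : Set (Set ι), MeasurableSet S := fun S => MeasurableSet.of_discrete
  have h := sahiE3_cylCompl_cylCompl_lower_nonneg_all p F G Xᶜ hX.compl
  rw [sahiE3_compl (prodBernoulli p) (hm _) (hm _) (hm _)] at h
  linarith

end SahiCylinderComplements

end Summit.CriticalPhenomena.PercolationContinuityZ3.Theorems
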